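import Summits.HodgeConjecture.CorCM.MultiFieldWeilCommutantNoGo
import Summits.HodgeConjecture.CorCM.MultiFieldWeilUnitSeparationSharp
import HarnessLib

/-!
# MULTI-FIELD WEIL ENGINE — NEVER THREE OVER THE DIHEDRAL PENTAGON: any three position sets over a slot of five letters whose image consists of rotations and reflections
# admit a non-constant solution of their signed equations (`dim_{ℚ(√5)} V₀ = 2`; census level)

Cell `pub-hodgecm2` (COR-CM), seat b30 gen 42 (2026-08-26); count-neutral own lane MULTI-FIELD WEIL ENGINE (stem `MultiFieldWeil*`), census level, the third no-go of the dihedral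
pentagon after `CorCM/MultiFieldWeilCommutantNoGo.lean` (cyclic slots: never two; dihedral: not the common-axis pairs).  Theorems only; no definition, no named fact, no `sorry`,
no `decide` beyond numerals of `Fin 5`.  HONEST FRAMING: pure finite combinatorics and linear algebra; `HC_CM` is NOT touched.

**`exists_nonconst_signed_of_dihedral_three`.**  If every `σ ∈ H ⊆ Sym(ℤ/5)` is a rotation `x ↦ x + t` or a reflection `x ↦ t − x`, then for ANY position sets `Q` indexed by `ι`
and any three DISTINCT indices `i₁, i₂, i₃` there are integer defects, one of `u_{i₁}, u_{i₂}, u_{i₃}` NOT constant, whose total signed sum vanishes at every `σ ∈ H`.  PROOF: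
the six vectors `c_l, A c_l` (`l = i₁, i₂, i₃`; `c` the centred indicators, `A c(s) = c(s+1)+c(s−1)−c(s+2)−c(s−2)`) in `ℚ^5` are linearly dependent; a dependency with cleared
denominators `Σ_l (z_l + 5 w_l A) c_l = 0` is a relation over the commutant `ℚ[A]` of `D₅` with the integer kernels `z_l (5δ − 1) + 5 w_l A`, and the COMMUTANT PRINCIPLE
`signed_eq_zero_of_kernel_relation` turns it into a solution, non-constant at any `l` with `(z_l, w_l) ≠ 0`.  READING: over a decic CM field with DIHEDRAL (or cyclic) quintic
part the units method never separates three `(2,3)`-classes — with `…DihedralFiveCriterion` and `…CommutantNoGo` the reach over a dihedral field is EXACTLY the pairs with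
different axes. [cite: Serre1977, §2.3 Ex. 2.6; §5.3] [cite: Lang2002, XIII §4; XVII §1] [cite: DixonMortimer1996, §2.1]

## References
* [Serre1977] J.-P. Serre, *Linear Representations of Finite Groups*, GTM 42, §2.3 Ex. 2.6, §5.3.  [Lang2002] S. Lang, *Algebra*, GTM 211, XIII §4, XVII §1.  [DixonMortimer1996]
  J. D. Dixon, B. Mortimer, *Permutation Groups*, GTM 163, §2.1.
-/

noncomputable section

namespace Summit.HodgeConjecture.CorCM.MultiFieldWeil

open Finset
open Fin.CommRing

open scoped Classical

section Three

variable {H : Finset (Equiv.Perm (Fin 5))}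

/-- **NEVER THREE OVER THE DIHEDRAL PENTAGON.**  See the module docstring. [cite: Serre1977, §5.3] [cite: Lang2002, XIII §4; XVII §1] -/
theorem exists_nonconst_signed_of_dihedral_three {ι : Type} [Fintype ι] [DecidableEq ι]
    (hH : ∀ σ ∈ H, ∃ t : Fin 5, (∀ x, σ x = x + t) ∨ (∀ x, σ x = t - x))
    (Q : ι → Finset (Fin 5)) {i₁ i₂ i₃ : ι} (h12 : i₁ ≠ i₂) (h13 : i₁ ≠ i₃) (h23 : i₂ ≠ i₃) :
    ∃ u : ι → Fin 5 → ℤ, (∃ i a b, u i a ≠ u i b) ∧ ∀ σ ∈ H, (∑ i, ∑ a, if σ a ∈ Q i then u i a else -u i a) = 0 := by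
  -- the three indices as a type
  let L : Type := {l : ι // l = i₁ ∨ l = i₂ ∨ l = i₃}
  -- rational centred indicators and their `A`-images
  let cq : ι → Fin 5 → ℚ := fun i s => 5 * (if s ∈ Q i then 1 else 0) - (Q i).card
  let v : L × Bool → (Fin 5 → ℚ) := fun p s => if p.2 then cq p.1.1 (s + 1) + cq p.1.1 (s - 1) - cq p.1.1 (s + 2) - cq p.1.1 (s - 2) else cq p.1.1 s
  -- six vectors in `ℚ^5` are dependent
  have hcardL : Fintype.card L = 3 := by
    have : ({i₁, i₂, i₃} : Finset ι).card = 3 := Finset.card_eq_three.2 ⟨i₁, i₂, i₃, h12, h13, h23, rfl⟩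
    rw [← this, ← Fintype.card_coe]
    refine Fintype.card_congr (Equiv.subtypeEquivRight fun l => ?_)
    simp only [Finset.mem_insert, Finset.mem_singleton]
  have hdep : ¬ LinearIndependent ℚ v := by
    intro hli
    have h := hli.fintype_card_le_finrank
    rw [Fintype.card_prod, Fintype.card_bool, hcardL, Module.finrank_fintype_fun_eq_card, Fintype.card_fin] at h
    omega
  obtain ⟨g, hg, p₀, hp₀⟩ := Fintype.not_linearIndependent_iff.1 hdep
  -- clear denominators
  set z : L × Bool → ℤ := fun p => (g p).num * ∏ q ∈ Finset.univ.erase p, ((g q).den : ℤ) with hzdef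
  have hz : ∀ p, (z p : ℚ) = g p * ∏ q, ((g q).den : ℚ) := fun p => by
    rw [hzdef, ← Finset.mul_prod_erase Finset.univ (fun q => ((g q).den : ℚ)) (Finset.mem_univ p), ← mul_assoc, Rat.mul_den_eq_num]
    push_cast
    rfl
  have hz₀ : z p₀ ≠ 0 :=
    mul_ne_zero (Rat.num_ne_zero.2 hp₀) (Finset.prod_ne_zero_iff.2 fun q _ => by exact_mod_cast (g q).den_ne_zero)
  have hD : (∏ q, ((g q).den : ℚ)) ≠ 0 := Finset.prod_ne_zero_iff.2 fun q _ => by exact_mod_cast (g q).den_ne_zero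
  -- the integer relation, pointwise
  have hrelq : ∀ s : Fin 5, (∑ p : L × Bool, (z p : ℚ) * v p s) = 0 := fun s => by
    have := congrFun hg s
    simp only [Finset.sum_apply, Pi.smul_apply, smul_eq_mul, Pi.zero_apply] at this
    rw [Finset.sum_congr rfl fun p _ => by rw [hz p, mul_right_comm], ← Finset.sum_mul, this, zero_mul]
  -- integer centred indicators and the two kernels
  set c : ι → Fin 5 → ℤ := fun i b => 5 * (if b ∈ Q i then 1 else 0) - (Q i).card with hc
  have hcq : ∀ i s, cq i s = (c i s : ℚ) := fun i s => by simp only [cq, hc]; push_cast; rfl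
  set I' : Fin 5 → Fin 5 → ℤ := fun a b => 5 * (if a = b then 1 else 0) - 1 with hI'
  set A : Fin 5 → Fin 5 → ℤ := fun a b => (if b - a = 1 ∨ b - a = 4 then 1 else 0) - (if b - a = 2 ∨ b - a = 3 then 1 else 0) with hA
  -- the coefficients of an index: `zf l`, `zt l` (zero outside the three indices)
  let zf : ι → ℤ := fun i => if h : i = i₁ ∨ i = i₂ ∨ i = i₃ then z (⟨i, h⟩, false) else 0
  let zt : ι → ℤ := fun i => if h : i = i₁ ∨ i = i₂ ∨ i = i₃ then z (⟨i, h⟩, true) else 0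
  set G : ι → Fin 5 → Fin 5 → ℤ := fun i a b => zf i * I' a b + 5 * zt i * A a b with hG
  -- invariance under rotations and reflections
  have hI'inv : ∀ (σ : Equiv.Perm (Fin 5)) a b, I' (σ a) (σ b) = I' a b := fun σ a b => by
    simp only [hI', σ.injective.eq_iff]
  have hAinv : ∀ σ ∈ H, ∀ a b, A (σ a) (σ b) = A a b := by
    intro σ hσ a b
    obtain ⟨t, ht | ht⟩ := hH σ hσ
    · simp only [hA, ht, add_sub_add_right_eq_sub]
    · have e : t - b - (t - a) = -(b - a) := by ring
      simp only [hA, ht, e]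
      have h14 : (-(b - a) = 1 ∨ -(b - a) = 4) ↔ (b - a = 1 ∨ b - a = 4) := by
        constructor
        · rintro (h | h)
          · right; linear_combination (-1 : Fin 5) * h - five_eq_zero_fin
          · left; linear_combination (-1 : Fin 5) * h - five_eq_zero_fin
        · rintro (h | h)
          · right; linear_combination (-1 : Fin 5) * h - five_eq_zero_fin
          · left; linear_combination (-1 : Fin 5) * h - five_eq_zero_fin
      have h23' : (-(b - a) = 2 ∨ -(b - a) = 3) ↔ (b - a = 2 ∨ b - a = 3) := by
        constructor
        · rintro (h | h)
          · right; linear_combination (-1 : Fin 5) * h - five_eq_zero_fin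
          · left; linear_combination (-1 : Fin 5) * h - five_eq_zero_fin
        · rintro (h | h)
          · right; linear_combination (-1 : Fin 5) * h - five_eq_zero_fin
          · left; linear_combination (-1 : Fin 5) * h - five_eq_zero_fin
      simp only [h14, h23']
  have hGinv : ∀ σ ∈ H, ∀ i a b, G i (σ a) (σ b) = G i a b := fun σ hσ i a b => by
    simp only [hG, hI'inv σ a b, hAinv σ hσ a b]
  -- zero row sums
  have hI'0 : ∀ b, ∑ a, I' b a = 0 := fun b => by
    simp only [hI', Finset.sum_sub_distrib, Finset.sum_const, Finset.card_univ, Fintype.card_fin]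
    rw [← Finset.mul_sum, Finset.sum_ite_eq]; simp
  have hA0 : ∀ b, ∑ a, A b a = 0 := fun b => by
    rw [← Equiv.sum_comp (Equiv.addRight b) (A b)]
    simp only [hA, Equiv.coe_addRight, add_sub_cancel_right, Fin.sum_univ_five]
    decide
  have hG0 : ∀ i b, ∑ a, G i b a = 0 := fun i b => by
    simp only [hG, Finset.sum_add_distrib, ← Finset.mul_sum, hI'0, hA0, mul_zero, add_zero]
  -- the actions of the kernels on the centred indicators
  have hc0 : ∀ i, ∑ b, c i b = 0 := fun i => by
    simp only [hc, Finset.sum_sub_distrib, ← Finset.mul_sum, Finset.sum_boole, Finset.sum_const, Finset.card_univ, Fintype.card_fin, nsmul_eq_mul]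
    simp
  have hI'act : ∀ i a, ∑ b, I' a b * c i b = 5 * c i a := fun i a => by
    have : ∀ b, I' a b * c i b = 5 * ((if a = b then 1 else 0) * c i b) - c i b := fun b => by simp only [hI']; ring
    rw [Finset.sum_congr rfl fun b _ => this b, Finset.sum_sub_distrib, ← Finset.mul_sum, hc0 i, sub_zero]
    congr 1
    simp only [ite_mul, one_mul, zero_mul, Finset.sum_ite_eq, Finset.mem_univ, if_true]
  have hAact : ∀ i a, ∑ b, A a b * c i b = c i (a + 1) + c i (a - 1) - c i (a + 2) - c i (a - 2) := fun i a => by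
    have hAv : ∀ j : Fin 5, A a (a + j) = (if j = 1 ∨ j = 4 then 1 else 0) - (if j = 2 ∨ j = 3 then 1 else 0) := fun j => by
      simp only [hA, add_sub_cancel_left]
    have hA0' : A a (a + 0) = 0 := by rw [hAv]; decide
    have hA1 : A a (a + 1) = 1 := by rw [hAv]; decide
    have hA2 : A a (a + 2) = -1 := by rw [hAv]; decide
    have hA3 : A a (a + 3) = -1 := by rw [hAv]; decide
    have hA4 : A a (a + 4) = 1 := by rw [hAv]; decide
    have e0 : a + (0 : Fin 5) = a := add_zero _
    have e3 : a + (3 : Fin 5) = a - 2 := by linear_combination five_eq_zero_fin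
    have e4 : a + (4 : Fin 5) = a - 1 := by linear_combination five_eq_zero_fin
    rw [← Equiv.sum_comp (Equiv.addLeft a) (fun b => A a b * c i b), Fin.sum_univ_five]
    simp only [Equiv.coe_addLeft]
    rw [hA0', hA1, hA2, hA3, hA4, e0, e3, e4]
    ring
  -- the relation `Σ_i Σ_b G_i(a, b) c_i(b) = 5 · (cleared dependency)(a) = 0`
  have hrel : ∀ a, ∑ i, ∑ b, G i a b * (((5 : ℕ) : ℤ) * (if b ∈ Q i then 1 else 0) - (Q i).card) = 0 := by
    intro a
    simp only [Nat.cast_ofNat]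
    have hterm : ∀ i, ∑ b, G i a b * ((5 : ℤ) * (if b ∈ Q i then 1 else 0) - (Q i).card) =
        5 * (zf i * c i a + zt i * (c i (a + 1) + c i (a - 1) - c i (a + 2) - c i (a - 2))) := fun i => by
      rw [show (fun b => G i a b * ((5 : ℤ) * (if b ∈ Q i then 1 else 0) - (Q i).card)) = fun b => zf i * (I' a b * c i b) + 5 * zt i * (A a b * c i b) from
        funext fun b => by simp only [hG, hc]; ring]
      rw [Finset.sum_add_distrib, ← Finset.mul_sum, ← Finset.mul_sum, hI'act, hAact]
      ring
    rw [Finset.sum_congr rfl fun i _ => hterm i, ← Finset.mul_sum]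
    -- the inner sum is the cleared dependency at `a`, read over the three indices
    have hsumι : (∑ i, (zf i * c i a + zt i * (c i (a + 1) + c i (a - 1) - c i (a + 2) - c i (a - 2)) : ℤ)) =
        ∑ l : L, (z (l, false) * c l.1 a + z (l, true) * (c l.1 (a + 1) + c l.1 (a - 1) - c l.1 (a + 2) - c l.1 (a - 2))) := by
      rw [← Finset.sum_filter_of_ne (s := Finset.univ) (p := fun i : ι => i = i₁ ∨ i = i₂ ∨ i = i₃) (fun i _ hne => by
        by_contra hi
        apply hne
        simp only [zf, zt, hi, dif_neg, not_false_eq_true, zero_mul, zero_add])]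
      rw [Finset.sum_subtype (Finset.univ.filter fun i : ι => i = i₁ ∨ i = i₂ ∨ i = i₃) (p := fun i : ι => i = i₁ ∨ i = i₂ ∨ i = i₃)
        (fun i => by simp only [Finset.mem_filter, Finset.mem_univ, true_and])]
      refine Finset.sum_congr rfl fun l _ => ?_
      simp only [zf, zt, dif_pos l.2]
    have hq : ((∑ l : L, (z (l, false) * c l.1 a + z (l, true) * (c l.1 (a + 1) + c l.1 (a - 1) - c l.1 (a + 2) - c l.1 (a - 2))) : ℤ) : ℚ) = 0 := by
      push_cast
      rw [← hrelq a, Fintype.sum_prod_type, ]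
      refine Finset.sum_congr rfl fun l _ => ?_
      rw [Fintype.sum_bool]
      simp only [v, if_true, Bool.false_eq_true, if_false, hcq]
      ring
    rw [hsumι]
    have : (∑ l : L, (z (l, false) * c l.1 a + z (l, true) * (c l.1 (a + 1) + c l.1 (a - 1) - c l.1 (a + 2) - c l.1 (a - 2))) : ℤ) = 0 := by
      exact_mod_cast hq
    rw [this, mul_zero]
  -- the solution and its non-constancy at the index of `p₀`
  refine ⟨fun i a => ∑ b, G i b a * (if b = 0 then 1 else 0), ?_, fun σ hσ => signed_eq_zero_of_kernel_relation Q G hGinv hG0 hrel _ σ hσ⟩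
  have hval : ∀ i a, (∑ b, G i b a * (if b = 0 then (1 : ℤ) else 0)) = G i 0 a := fun i a => by
    rw [Finset.sum_eq_single (0 : Fin 5) (fun b _ hb => by rw [if_neg hb, mul_zero]) (fun h => absurd (Finset.mem_univ _) h), if_pos rfl, mul_one]
  obtain ⟨l₀, b₀⟩ := p₀
  refine ⟨l₀.1, ?_⟩
  have hzf' : zf l₀.1 = z (l₀, false) := by simp only [zf, dif_pos l₀.2, Subtype.coe_eta]
  have hzt' : zt l₀.1 = z (l₀, true) := by simp only [zt, dif_pos l₀.2, Subtype.coe_eta]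
  have i00 : I' 0 0 = 4 := by simp only [hI']; decide
  have i01 : I' 0 1 = -1 := by simp only [hI']; decide
  have i02 : I' 0 2 = -1 := by simp only [hI']; decide
  have a00 : A 0 0 = 0 := by simp only [hA]; decide
  have a01 : A 0 1 = 1 := by simp only [hA]; decide
  have a02 : A 0 2 = -1 := by simp only [hA]; decide
  have g0 : G l₀.1 0 0 = zf l₀.1 * 4 + 5 * zt l₀.1 * 0 := by simp only [hG, i00, a00]
  have g1 : G l₀.1 0 1 = zf l₀.1 * (-1) + 5 * zt l₀.1 * 1 := by simp only [hG, i01, a01]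
  have g2 : G l₀.1 0 2 = zf l₀.1 * (-1) + 5 * zt l₀.1 * (-1) := by simp only [hG, i02, a02]
  by_contra hall
  push Not at hall
  have e01 : (∑ b, G l₀.1 b 0 * (if b = 0 then (1 : ℤ) else 0)) = ∑ b, G l₀.1 b 1 * (if b = 0 then (1 : ℤ) else 0) := hall 0 1
  have e02 : (∑ b, G l₀.1 b 0 * (if b = 0 then (1 : ℤ) else 0)) = ∑ b, G l₀.1 b 2 * (if b = 0 then (1 : ℤ) else 0) := hall 0 2
  rw [hval, hval, g0, g1] at e01
  rw [hval, hval, g0, g2] at e02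
  have hzt : zt l₀.1 = 0 := by linarith
  have hzf : zf l₀.1 = 0 := by linarith
  rw [hzf'] at hzf
  rw [hzt'] at hzt
  cases b₀
  · exact hz₀ hzf
  · exact hz₀ hzt

end Three

end Summit.HodgeConjecture.CorCM.MultiFieldWeil

end
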